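import Summits.QuantumFields.GaugeBoot.LoopEquationSchema
import Summits.QuantumFields.GaugeBoot.LoopEquationSU2Loops
import Summits.QuantumFields.GaugeBoot.WordLoop
import HarnessLib

/-!
# The single-link loop equation in the generators' REAL PAIR normal form, every `N` (cell `gauge-boot`, L1)

Honest framing (cell rule): certified bounds on lattice expectations at stated coupling, gauge group, dimension and
torus size; NOT a mass gap, NOT a continuum limit, NOT a string tension, NOT large `N`; not summit-bearing
(`FixedCouplingUltralocality`, `PerturbativeInvisibility`).  This file enters NO bound, NO certificate and NO index row.

`LoopEquation.lean` proves the single-link Schwinger–Dyson identity of lattice `SU(N)` / `U(N)` Yang–Mills on the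
torus `(ℤ/L)^d` in COMPLEX TRACE form (`× N²`), and `LoopEquationSchema.lean` decides its occurrence sets on `ℤ^d`.
For `SU(2)` the generators write their rows in single loops (`LoopEquationSU2Loops.lean`, `tr A·tr B = tr AB + tr AB⁻¹`).
For `N ≥ 3` no such reduction exists: the generators of this cell (eng2 `G2` `su3_kz_instance.py` / `mm_row`, eng1
`G1`) keep, next to the single-loop variables `w(C) = ⟨(1/N) Re tr hol C⟩_β`, the PAIR variables
`d(A, B) = Re ⟨tr hol A · tr hol B⟩_β / N²` of two loops at a common base point, and write every single-link row,
after division by `N²` and passage to real parts, as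

`Σ_{k ∈ fwdOcc} (d(w[0,k), w[k,n)) − s·w(w)/N²) − Σ_{k ∈ bwdOcc} (d(w[0,k], w(k,n)) − s·w(w)/N²)`
`  + (β/(2N))·Σ_{ν ≠ μ} Σ_{ε = ±} (w(w·P̃) − w(w·P̃⁻¹) − s·(d(w, P̃) − d(w, P̃⁻¹))) = 0`

(`s = 1` for `SU(N)`, `s = 0` for `U(N)`; `P̃ = plaqWord μ ν ε` the `2(d−1)` plaquettes through the link, oriented to
start with it; `β` the tree coupling `β_std/N`, so that `β/(2N) = 1/λ` with `λ = 2N²/β_std` of Kazakov–Zheng; the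
marked letter itself, `k = 0`, contributes `d([], w) − s·w(w)/N² = (1 − s/N²)·w(w)`).  This file proves exactly
that, for an ARBITRARY closed word and every `N`, as a theorem about the finite torus (every real `β`, every `d`, every
`L` for which the word is small):

* `loopEquation_pairForm` — for any compact `G` with lattice representation `r` satisfying the pair identities
  (`SDPair`, as in `loopEquation_schema`), real weight `s`;
* `loopEquation_pairForm_specialUnitaryGroup` (`s = 1`), `loopEquation_pairForm_unitaryGroup` (`s = 0`: no `1/N²`
  and no pair plaquette terms), `loopEquation_pairForm_su_three` (the numerals `9` and `β/6` of the cell's `SU(3)`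
  problem files), `loopEquation_pairForm_specialUnitaryGroup_of_dispBound` (smallness from a decidable displacement
  bound), and the instance `loopEquation_pairForm_su_three_plaquette` (`d = 3`, marked plaquette, `L ≥ 3`:
  `(8/9)·w(P) + (β/6)·Σ_{ν ≠ 0, ε} (w(P·P̃) − w(P·P̃⁻¹) − (d(P, P̃) − d(P, P̃⁻¹))) = 0`, occurrence sets by `decide`);
* the dictionary lemmas `wilsonExpectation_wordLoop_eq_re_integral_latticeRep` (`w(C) = (1/N) Re E[tr hol C]`),
  `re_integral_trace_nil_mul_trace_latticeRep` / `re_integral_trace_nil_mul_trace_specialUnitaryGroup`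
  (`d([], C) = w(C)`: the marked-letter coefficient `1 − s/N²`), and the integrated split / plaquette terms.

The variables are WRITTEN OUT (`wilsonExpectation ρ β (wordLoop ρ x C)`, `(∫ tr ρ(hol_x A)·tr ρ(hol_x B) dμ_β).re / N²`);
no definition is introduced.  Identifying prefixes / suffixes / plaquette-extended words and positioned pairs with
canonical classes is the generators' bookkeeping (pairs need JOINT moves only), not done here; nothing here is a
certificate row.  Everything is `[folklore]`: Makeenko–Migdal / Kazakov–Zheng (arXiv:2203.11360 (2.5)–(2.7),
arXiv:2404.16925 §2) / Guo–Li–Yang–Zhu (arXiv:2502.14421 §2) finite-`N` lattice loop equations.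
-/

noncomputable section

open MeasureTheory
open scoped Matrix
open Literature.MathematicalPhysics.QuantumFieldTheory
open Literature.MathematicalPhysics.QuantumLattice

namespace Summit.QuantumFields.GaugeBoot

variable {d L : ℕ}

section RealParts

/-- `Re((β/2)·z) = (β/2)·Re z` for real `β`. [folklore] -/
theorem re_ofReal_div_two_mul (β : ℝ) (z : ℂ) : ((β / 2 : ℂ) * z).re = β / 2 * z.re := by
  rw [show (β / 2 : ℂ) = ((β / 2 : ℝ) : ℂ) by rw [Complex.ofReal_div, Complex.ofReal_ofNat],
    Complex.re_ofReal_mul]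

/-- `Re((s/N)·z) = (s/N)·Re z` for real `s` and natural `N`. [folklore] -/
theorem re_ofReal_div_natCast_mul (s : ℝ) (N : ℕ) (z : ℂ) : ((s : ℂ) / (N : ℂ) * z).re = s / N * z.re := by
  rw [show (s : ℂ) / (N : ℂ) = ((s / N : ℝ) : ℂ) by rw [Complex.ofReal_div, Complex.ofReal_natCast],
    Complex.re_ofReal_mul]

end RealParts

/-! ## Integrated split and plaquette terms, and the dictionary to the real variables (any lattice representation) -/

section LatticeRepGeneral

variable {G : Type} [Group G] [TopologicalSpace G] [IsTopologicalGroup G] [CompactSpace G] [MeasurableSpace G]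
  [BorelSpace G] (r : LatticeRep G) [NeZero L]

/-- `U ↦ tr ρ(hol_x(v)(U))` is integrable for Wilson's measure (every real `β`). [folklore] -/
theorem integrable_trace_wordHolonomy_latticeRep (β : ℝ) (x : Site d L) (v : Word d) :
    Integrable (fun U : GaugeConfig d L G => (r.ρ (wordHolonomy U x v)).trace)
      (wilsonMeasure (d := d) (L := L) r.ρ β) :=
  integrable_of_continuous r β (continuous_trace_wordHolonomy r x v)

/-- `U ↦ tr ρ(hol_x(u)) · tr ρ(hol_y(v))` is integrable for Wilson's measure. [folklore] -/
theorem integrable_trace_mul_trace_latticeRep (β : ℝ) (x y : Site d L) (u v : Word d) :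
    Integrable (fun U : GaugeConfig d L G => (r.ρ (wordHolonomy U x u)).trace * (r.ρ (wordHolonomy U y v)).trace)
      (wilsonMeasure (d := d) (L := L) r.ρ β) :=
  integrable_of_continuous r β ((continuous_trace_wordHolonomy r x u).mul (continuous_trace_wordHolonomy r y v))

/-- **`w(C) = (1/N) Re E[tr hol C]`** for any lattice representation: the tree's loop variable `⟨wordLoop⟩_β` is the
normalised real part of the complex loop expectation. [folklore] -/
theorem wilsonExpectation_wordLoop_eq_re_integral_latticeRep (β : ℝ) (x : Site d L) (v : Word d) :
    wilsonExpectation (d := d) (L := L) r.ρ β (wordLoop r.ρ x v) =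
      (r.N : ℝ)⁻¹ * (∫ U, (r.ρ (wordHolonomy U x v)).trace ∂(wilsonMeasure (d := d) (L := L) r.ρ β)).re := by
  have h := integral_re (integrable_trace_wordHolonomy_latticeRep (d := d) (L := L) r β x v)
  simp only [RCLike.re_to_complex] at h
  simp only [wilsonExpectation, wordLoop_apply, integral_const_mul, h]

/-- **The marked letter: `d([], C) = w(C)`** — `Re E[tr ρ(hol []) · tr ρ(hol C)] / N² = (1/N) Re E[tr ρ(hol C)]`
(`hol [] = 1`, `tr 1 = N`), whence the coefficient `1 − s/N²` of `w(w)` in the generators' rows. [folklore] -/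
theorem re_integral_trace_nil_mul_trace_latticeRep (β : ℝ) (x : Site d L) (v : Word d) :
    (∫ U, (r.ρ (wordHolonomy U x ([] : Word d))).trace * (r.ρ (wordHolonomy U x v)).trace
        ∂(wilsonMeasure (d := d) (L := L) r.ρ β)).re / (r.N : ℝ) ^ 2 =
      wilsonExpectation (d := d) (L := L) r.ρ β (wordLoop r.ρ x v) := by
  simp only [wordHolonomy_nil, map_one, Matrix.trace_one, Fintype.card_fin]
  rw [integral_const_mul, ← Complex.ofReal_natCast, Complex.re_ofReal_mul,
    wilsonExpectation_wordLoop_eq_re_integral_latticeRep]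
  by_cases hN : (r.N : ℝ) = 0
  · simp [hN]
  · field_simp

/-- **The split term, integrated**: for a prefix `w[0,k)` returning to `x`,
`∫ (tr A_k · tr B_k − (s/N) tr W) dμ_β = E[tr A_k · tr B_k] − (s/N)·E[tr W]` with both factors read from `x`. [folklore] -/
theorem integral_splitTerm_latticeRep (β : ℝ) (s : ℂ) (x : Site d L) (w : Word d) {k : ℕ}
    (hk : Word.siteAt x w k = x) :
    ∫ U, ((r.ρ (wordHolonomy U x (w.take k))).trace * (r.ρ (wordHolonomy U (Word.siteAt x w k) (w.drop k))).trace -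
        s / r.N * (r.ρ (wordHolonomy U x w)).trace) ∂(wilsonMeasure (d := d) (L := L) r.ρ β) =
      (∫ U, (r.ρ (wordHolonomy U x (w.take k))).trace * (r.ρ (wordHolonomy U x (w.drop k))).trace
          ∂(wilsonMeasure (d := d) (L := L) r.ρ β)) -
        s / r.N * ∫ U, (r.ρ (wordHolonomy U x w)).trace ∂(wilsonMeasure (d := d) (L := L) r.ρ β) := by
  rw [hk, integral_sub (integrable_trace_mul_trace_latticeRep r β x x _ _)
      ((integrable_trace_wordHolonomy_latticeRep r β x w).const_mul _), integral_const_mul]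

/-- **The plaquette term, integrated**: `∫ plaqTerm_{ν,ε}(w) dμ_β = E[tr hol(w·P̃)] − E[tr hol(w·P̃⁻¹)]
− (s/N)·(E[tr hol w · tr hol P̃] − E[tr hol w · tr hol P̃⁻¹])`, `P̃ = plaqWord μ ν ε`. [folklore] -/
theorem integral_plaqTerm_latticeRep (β : ℝ) (s : ℂ) (x : Site d L) (μ : Fin d) (w : Word d) (ν : Fin d)
    (ε : Bool) :
    ∫ U, plaqTerm r.ρ s x μ U w ν ε ∂(wilsonMeasure (d := d) (L := L) r.ρ β) =
      (∫ U, (r.ρ (wordHolonomy U x (w ++ plaqWord μ ν ε))).trace ∂(wilsonMeasure (d := d) (L := L) r.ρ β)) -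
        (∫ U, (r.ρ (wordHolonomy U x (w ++ (plaqWord μ ν ε).reverse))).trace
          ∂(wilsonMeasure (d := d) (L := L) r.ρ β)) -
        s / r.N * ((∫ U, (r.ρ (wordHolonomy U x w)).trace * (r.ρ (wordHolonomy U x (plaqWord μ ν ε))).trace
            ∂(wilsonMeasure (d := d) (L := L) r.ρ β)) -
          (∫ U, (r.ρ (wordHolonomy U x w)).trace * (r.ρ (wordHolonomy U x (plaqWord μ ν ε).reverse)).trace
            ∂(wilsonMeasure (d := d) (L := L) r.ρ β))) := by
  have hA := integrable_trace_wordHolonomy_latticeRep (d := d) (L := L) r β x (w ++ plaqWord μ ν ε)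
  have hB := integrable_trace_wordHolonomy_latticeRep (d := d) (L := L) r β x (w ++ (plaqWord μ ν ε).reverse)
  have hP := integrable_trace_mul_trace_latticeRep (d := d) (L := L) r β x x w (plaqWord μ ν ε)
  have hQ := integrable_trace_mul_trace_latticeRep (d := d) (L := L) r β x x w (plaqWord μ ν ε).reverse
  have hAB : Integrable (fun U : GaugeConfig d L G =>
      (r.ρ (wordHolonomy U x (w ++ plaqWord μ ν ε))).trace -
        (r.ρ (wordHolonomy U x (w ++ (plaqWord μ ν ε).reverse))).trace) (wilsonMeasure (d := d) (L := L) r.ρ β) :=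
    hA.sub hB
  have hPQ : Integrable (fun U : GaugeConfig d L G =>
      s / r.N * ((r.ρ (wordHolonomy U x w)).trace * (r.ρ (wordHolonomy U x (plaqWord μ ν ε))).trace) -
        s / r.N * ((r.ρ (wordHolonomy U x w)).trace * (r.ρ (wordHolonomy U x (plaqWord μ ν ε).reverse)).trace))
      (wilsonMeasure (d := d) (L := L) r.ρ β) :=
    (hP.const_mul _).sub (hQ.const_mul _)
  simp only [plaqTerm, mul_sub]
  rw [integral_sub hAB hPQ, integral_sub hA hB, integral_sub (hP.const_mul _) (hQ.const_mul _), integral_const_mul,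
    integral_const_mul]

/-- **THE SINGLE-LINK LOOP EQUATION IN REAL PAIR NORMAL FORM (any lattice representation).**  For a compact `G` with
lattice representation `r` satisfying the pair identities at `(x, μ)` for the contractions `unitDir s` (`SDPair`; `SU(N)`:
`s = 1`, `U(N)`: `s = 0`), a word `w` closed at `x` and small for the torus, with
`w(C) = wilsonExpectation r.ρ β (wordLoop r.ρ x C)` and `d(A, B) = (∫ tr r.ρ(hol_x A) · tr r.ρ(hol_x B) dμ_β).re / N²`:
`Σ_{k ∈ fwdOccZ} (d(w[0,k), w[k,n)) − s·w(w)/N²) − Σ_{k ∈ bwdOccZ} (d(w[0,k], w(k,n)) − s·w(w)/N²)`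
`+ (β/(2N))·Σ_{ν ≠ μ} Σ_ε (w(w·P̃) − w(w·P̃⁻¹) − s·(d(w, P̃) − d(w, P̃⁻¹))) = 0`
— the complex trace identity `loopEquation_schema` divided by `N²`, real parts taken. [folklore] -/
theorem loopEquation_pairForm (β : ℝ) (x : Site d L) (μ : Fin d) (s : ℝ) (w : Word d)
    (hw : Word.endpoint x w = x) (hsm : w.Small L)
    (hP : ∀ i j : Fin r.N, SDPair r β x μ x w (unitDir (s : ℂ) i j)) :
    (∑ k ∈ (Finset.range w.length).filter (w.fwdOccZ μ),
        ((∫ U, (r.ρ (wordHolonomy U x (w.take k))).trace * (r.ρ (wordHolonomy U x (w.drop k))).trace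
            ∂(wilsonMeasure (d := d) (L := L) r.ρ β)).re / (r.N : ℝ) ^ 2 -
          s * (wilsonExpectation (d := d) (L := L) r.ρ β (wordLoop r.ρ x w) / (r.N : ℝ) ^ 2))) -
      (∑ k ∈ (Finset.range w.length).filter (w.bwdOccZ μ),
        ((∫ U, (r.ρ (wordHolonomy U x (w.take (k + 1)))).trace * (r.ρ (wordHolonomy U x (w.drop (k + 1)))).trace
            ∂(wilsonMeasure (d := d) (L := L) r.ρ β)).re / (r.N : ℝ) ^ 2 -
          s * (wilsonExpectation (d := d) (L := L) r.ρ β (wordLoop r.ρ x w) / (r.N : ℝ) ^ 2))) +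
      β / (2 * r.N) * ∑ ν ∈ Finset.univ.erase μ, ∑ ε : Bool,
        (wilsonExpectation (d := d) (L := L) r.ρ β (wordLoop r.ρ x (w ++ plaqWord μ ν ε)) -
          wilsonExpectation (d := d) (L := L) r.ρ β (wordLoop r.ρ x (w ++ (plaqWord μ ν ε).reverse)) -
          s * ((∫ U, (r.ρ (wordHolonomy U x w)).trace * (r.ρ (wordHolonomy U x (plaqWord μ ν ε))).trace
                ∂(wilsonMeasure (d := d) (L := L) r.ρ β)).re / (r.N : ℝ) ^ 2 -
            (∫ U, (r.ρ (wordHolonomy U x w)).trace * (r.ρ (wordHolonomy U x (plaqWord μ ν ε).reverse)).trace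
                ∂(wilsonMeasure (d := d) (L := L) r.ρ β)).re / (r.N : ℝ) ^ 2)) = 0 := by
  have h := loopEquation_schema r β x μ (s : ℂ) w hw hsm hP
  -- forward occurrences: the prefix `w[0,k)` is closed at `x`
  have hf : ∀ k ∈ (Finset.range w.length).filter (w.fwdOccZ μ), Word.siteAt x w k = x := fun k hk =>
    (Word.siteAt_eq_iff hsm x k).2 (Finset.mem_filter.1 hk).2.2
  -- backward occurrences: the prefix `w[0,k]` is closed at `x`
  have hb : ∀ k ∈ (Finset.range w.length).filter (w.bwdOccZ μ), Word.siteAt x w (k + 1) = x := fun k hk => by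
    obtain ⟨hk1, hk2⟩ := (Finset.mem_filter.1 hk).2
    refine (Word.siteAt_eq_iff hsm x (k + 1)).2 ?_
    rw [Word.dispZ_succ_of_getElem? hk1, hk2]
    ext i
    by_cases hi : i = μ
    · subst hi; simp [Step.dispZ]
    · simp [Step.dispZ, hi]
  rw [Finset.sum_congr rfl fun k hk => integral_splitTerm_latticeRep r β (s : ℂ) x w (hf k hk),
    Finset.sum_congr rfl fun k hk => integral_splitTerm_latticeRep r β (s : ℂ) x w (hb k hk)] at h
  simp only [integral_plaqTerm_latticeRep] at h
  have hre := congrArg Complex.re h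
  simp only [Complex.re_sum, Complex.add_re, Complex.sub_re, Complex.zero_re, re_ofReal_div_two_mul,
    re_ofReal_div_natCast_mul] at hre
  have h2 := congrArg (fun t : ℝ => 1 / (r.N : ℝ) ^ 2 * t) hre
  simp only [mul_zero, mul_add, mul_sub, Finset.mul_sum] at h2
  simp_rw [wilsonExpectation_wordLoop_eq_re_integral_latticeRep r β x]
  convert h2 using 2
  · congr 1
    · exact Finset.sum_congr rfl fun k _ => by ring
    · exact Finset.sum_congr rfl fun k _ => by ring
  · rw [Finset.mul_sum]
    refine Finset.sum_congr rfl fun ν _ => ?_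
    rw [Finset.mul_sum]
    exact Finset.sum_congr rfl fun ε _ => by ring

end LatticeRepGeneral

/-! ## `SU(N)`, `U(N)`, `SU(3)` -/

section Concrete

variable [NeZero L]

/-- **THE `SU(N)` LOOP EQUATION IN REAL PAIR NORMAL FORM** (every `N`, every real `β`, every `d`; `w` closed at `x`
and small for `(ℤ/L)^d`).  With `w(C) = wilsonExpectation ρ β (wordLoop ρ x C)` (`= (1/N) Re E[tr hol C]`) and
`d(A, B) = (∫ tr ρ(hol_x A) · tr ρ(hol_x B) dμ_β).re / N²`, `ρ` the fundamental representation: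
`Σ_{k ∈ fwdOccZ} (d(w[0,k), w[k,n)) − w(w)/N²) − Σ_{k ∈ bwdOccZ} (d(w[0,k], w(k,n)) − w(w)/N²)`
`+ (β/(2N))·Σ_{ν ≠ μ} Σ_ε (w(w·P̃) − w(w·P̃⁻¹) − (d(w, P̃) − d(w, P̃⁻¹))) = 0`
— the generators' `SU(N)` row of the marked word before canonicalisation (eng2 `G2` `mm_row`: marked letter
`(1 − 1/N²)·w`, each further forward traversal `+d − w/N²`, each backward one `−d + w/N²`, plaquettes with `1/λ = β/(2N)`).
[folklore] -/
theorem loopEquation_pairForm_specialUnitaryGroup (N : ℕ) (β : ℝ) (x : Site d L) (μ : Fin d) (w : Word d)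
    (hw : Word.endpoint x w = x) (hsm : w.Small L) :
    (∑ k ∈ (Finset.range w.length).filter (w.fwdOccZ μ),
        ((∫ U, (fundamentalRep (Fin N) (wordHolonomy U x (w.take k))).trace *
              (fundamentalRep (Fin N) (wordHolonomy U x (w.drop k))).trace
            ∂(wilsonMeasure (d := d) (L := L) (fundamentalRep (Fin N)) β)).re / (N : ℝ) ^ 2 -
          wilsonExpectation (d := d) (L := L) (fundamentalRep (Fin N)) β
              (wordLoop (fundamentalRep (Fin N)) x w) / (N : ℝ) ^ 2)) -
      (∑ k ∈ (Finset.range w.length).filter (w.bwdOccZ μ),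
        ((∫ U, (fundamentalRep (Fin N) (wordHolonomy U x (w.take (k + 1)))).trace *
              (fundamentalRep (Fin N) (wordHolonomy U x (w.drop (k + 1)))).trace
            ∂(wilsonMeasure (d := d) (L := L) (fundamentalRep (Fin N)) β)).re / (N : ℝ) ^ 2 -
          wilsonExpectation (d := d) (L := L) (fundamentalRep (Fin N)) β
              (wordLoop (fundamentalRep (Fin N)) x w) / (N : ℝ) ^ 2)) +
      β / (2 * N) * ∑ ν ∈ Finset.univ.erase μ, ∑ ε : Bool,
        (wilsonExpectation (d := d) (L := L) (fundamentalRep (Fin N)) β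
            (wordLoop (fundamentalRep (Fin N)) x (w ++ plaqWord μ ν ε)) -
          wilsonExpectation (d := d) (L := L) (fundamentalRep (Fin N)) β
            (wordLoop (fundamentalRep (Fin N)) x (w ++ (plaqWord μ ν ε).reverse)) -
          ((∫ U, (fundamentalRep (Fin N) (wordHolonomy U x w)).trace *
                (fundamentalRep (Fin N) (wordHolonomy U x (plaqWord μ ν ε))).trace
              ∂(wilsonMeasure (d := d) (L := L) (fundamentalRep (Fin N)) β)).re / (N : ℝ) ^ 2 -
            (∫ U, (fundamentalRep (Fin N) (wordHolonomy U x w)).trace *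
                (fundamentalRep (Fin N) (wordHolonomy U x (plaqWord μ ν ε).reverse)).trace
              ∂(wilsonMeasure (d := d) (L := L) (fundamentalRep (Fin N)) β)).re / (N : ℝ) ^ 2)) = 0 := by
  have h := loopEquation_pairForm (fundamentalLatticeRep N) β x μ 1 w hw hsm
    fun i j => sdPair_specialUnitaryGroup N β x μ x w _ (by rw [Complex.ofReal_one]; exact trace_unitDir_one i j)
  simp only [one_mul] at h
  exact h

/-- **THE `U(N)` LOOP EQUATION IN REAL PAIR NORMAL FORM** (`s = 0`: no `1/N²` terms and no pair plaquette terms):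
`Σ_{k ∈ fwdOccZ} d(w[0,k), w[k,n)) − Σ_{k ∈ bwdOccZ} d(w[0,k], w(k,n)) + (β/(2N))·Σ_{ν ≠ μ} Σ_ε (w(w·P̃) − w(w·P̃⁻¹)) = 0`
(defining representation of `U(N)`; `w`, `d` as above). [folklore] -/
theorem loopEquation_pairForm_unitaryGroup (N : ℕ) (β : ℝ) (x : Site d L) (μ : Fin d) (w : Word d)
    (hw : Word.endpoint x w = x) (hsm : w.Small L) :
    (∑ k ∈ (Finset.range w.length).filter (w.fwdOccZ μ),
        (∫ U, (unitaryFundamentalRep (Fin N) ℂ (wordHolonomy U x (w.take k))).trace *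
              (unitaryFundamentalRep (Fin N) ℂ (wordHolonomy U x (w.drop k))).trace
            ∂(wilsonMeasure (d := d) (L := L) (unitaryFundamentalRep (Fin N) ℂ) β)).re / (N : ℝ) ^ 2) -
      (∑ k ∈ (Finset.range w.length).filter (w.bwdOccZ μ),
        (∫ U, (unitaryFundamentalRep (Fin N) ℂ (wordHolonomy U x (w.take (k + 1)))).trace *
              (unitaryFundamentalRep (Fin N) ℂ (wordHolonomy U x (w.drop (k + 1)))).trace
            ∂(wilsonMeasure (d := d) (L := L) (unitaryFundamentalRep (Fin N) ℂ) β)).re / (N : ℝ) ^ 2) +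
      β / (2 * N) * ∑ ν ∈ Finset.univ.erase μ, ∑ ε : Bool,
        (wilsonExpectation (d := d) (L := L) (unitaryFundamentalRep (Fin N) ℂ) β
            (wordLoop (unitaryFundamentalRep (Fin N) ℂ) x (w ++ plaqWord μ ν ε)) -
          wilsonExpectation (d := d) (L := L) (unitaryFundamentalRep (Fin N) ℂ) β
            (wordLoop (unitaryFundamentalRep (Fin N) ℂ) x (w ++ (plaqWord μ ν ε).reverse))) = 0 := by
  have h := loopEquation_pairForm (unitaryFundamentalLatticeRep N) β x μ 0 w hw hsm
    fun i j => sdPair_unitaryGroup N β x μ x w _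
  simp only [zero_mul, sub_zero] at h
  exact h

/-- **`SU(N)`: the marked letter `d([], C) = w(C)`** (fundamental representation). [folklore] -/
theorem re_integral_trace_nil_mul_trace_specialUnitaryGroup (N : ℕ) (β : ℝ) (x : Site d L) (v : Word d) :
    (∫ U, (fundamentalRep (Fin N) (wordHolonomy U x ([] : Word d))).trace *
          (fundamentalRep (Fin N) (wordHolonomy U x v)).trace
        ∂(wilsonMeasure (d := d) (L := L) (fundamentalRep (Fin N)) β)).re / (N : ℝ) ^ 2 =
      wilsonExpectation (d := d) (L := L) (fundamentalRep (Fin N)) β (wordLoop (fundamentalRep (Fin N)) x v) :=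
  re_integral_trace_nil_mul_trace_latticeRep (fundamentalLatticeRep N) β x v

/-- **THE `SU(3)` LOOP EQUATION IN REAL PAIR NORMAL FORM, with the numerals of the cell's `SU(3)` problem files**
(`w = ⟨(1/3) Re tr⟩`, `d = Re E[tr·tr]/9`, plaquette coefficient `β/6 = 1/λ`):
`Σ_{k ∈ fwdOccZ} (d(w[0,k), w[k,n)) − w(w)/9) − Σ_{k ∈ bwdOccZ} (d(w[0,k], w(k,n)) − w(w)/9)`
`+ (β/6)·Σ_{ν ≠ μ} Σ_ε (w(w·P̃) − w(w·P̃⁻¹) − (d(w, P̃) − d(w, P̃⁻¹))) = 0`.  Not a certificate row: the row of a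
problem file is this identity for its marked word with every label canonicalised. [folklore] -/
theorem loopEquation_pairForm_su_three (β : ℝ) (x : Site d L) (μ : Fin d) (w : Word d)
    (hw : Word.endpoint x w = x) (hsm : w.Small L) :
    (∑ k ∈ (Finset.range w.length).filter (w.fwdOccZ μ),
        ((∫ U, (fundamentalRep (Fin 3) (wordHolonomy U x (w.take k))).trace *
              (fundamentalRep (Fin 3) (wordHolonomy U x (w.drop k))).trace
            ∂(wilsonMeasure (d := d) (L := L) (fundamentalRep (Fin 3)) β)).re / 9 -
          wilsonExpectation (d := d) (L := L) (fundamentalRep (Fin 3)) β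
              (wordLoop (fundamentalRep (Fin 3)) x w) / 9)) -
      (∑ k ∈ (Finset.range w.length).filter (w.bwdOccZ μ),
        ((∫ U, (fundamentalRep (Fin 3) (wordHolonomy U x (w.take (k + 1)))).trace *
              (fundamentalRep (Fin 3) (wordHolonomy U x (w.drop (k + 1)))).trace
            ∂(wilsonMeasure (d := d) (L := L) (fundamentalRep (Fin 3)) β)).re / 9 -
          wilsonExpectation (d := d) (L := L) (fundamentalRep (Fin 3)) β
              (wordLoop (fundamentalRep (Fin 3)) x w) / 9)) +
      β / 6 * ∑ ν ∈ Finset.univ.erase μ, ∑ ε : Bool,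
        (wilsonExpectation (d := d) (L := L) (fundamentalRep (Fin 3)) β
            (wordLoop (fundamentalRep (Fin 3)) x (w ++ plaqWord μ ν ε)) -
          wilsonExpectation (d := d) (L := L) (fundamentalRep (Fin 3)) β
            (wordLoop (fundamentalRep (Fin 3)) x (w ++ (plaqWord μ ν ε).reverse)) -
          ((∫ U, (fundamentalRep (Fin 3) (wordHolonomy U x w)).trace *
                (fundamentalRep (Fin 3) (wordHolonomy U x (plaqWord μ ν ε))).trace
              ∂(wilsonMeasure (d := d) (L := L) (fundamentalRep (Fin 3)) β)).re / 9 -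
            (∫ U, (fundamentalRep (Fin 3) (wordHolonomy U x w)).trace *
                (fundamentalRep (Fin 3) (wordHolonomy U x (plaqWord μ ν ε).reverse)).trace
              ∂(wilsonMeasure (d := d) (L := L) (fundamentalRep (Fin 3)) β)).re / 9)) = 0 := by
  have h := loopEquation_pairForm_specialUnitaryGroup (L := L) 3 β x μ w hw hsm
  simp only [show ((3 : ℕ) : ℝ) ^ 2 = 9 by norm_num, show (2 * ((3 : ℕ) : ℝ) : ℝ) = 6 by norm_num] at h
  exact h

/-- **Smallness from a displacement bound** (restated for one-line use): `Word.DispBound B` (decidable for explicit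
words) and `B + 2 ≤ L` make `w` small for `(ℤ/L)^d`, so `loopEquation_pairForm_specialUnitaryGroup` applies on every
such torus. [folklore] -/
theorem loopEquation_pairForm_specialUnitaryGroup_of_dispBound (N : ℕ) (β : ℝ) (x : Site d L) (μ : Fin d)
    (w : Word d) (hw : Word.endpoint x w = x) {B : ℕ} (hB : w.DispBound B) (hL : B + 2 ≤ L) :
    (∑ k ∈ (Finset.range w.length).filter (w.fwdOccZ μ),
        ((∫ U, (fundamentalRep (Fin N) (wordHolonomy U x (w.take k))).trace *
              (fundamentalRep (Fin N) (wordHolonomy U x (w.drop k))).trace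
            ∂(wilsonMeasure (d := d) (L := L) (fundamentalRep (Fin N)) β)).re / (N : ℝ) ^ 2 -
          wilsonExpectation (d := d) (L := L) (fundamentalRep (Fin N)) β
              (wordLoop (fundamentalRep (Fin N)) x w) / (N : ℝ) ^ 2)) -
      (∑ k ∈ (Finset.range w.length).filter (w.bwdOccZ μ),
        ((∫ U, (fundamentalRep (Fin N) (wordHolonomy U x (w.take (k + 1)))).trace *
              (fundamentalRep (Fin N) (wordHolonomy U x (w.drop (k + 1)))).trace
            ∂(wilsonMeasure (d := d) (L := L) (fundamentalRep (Fin N)) β)).re / (N : ℝ) ^ 2 -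
          wilsonExpectation (d := d) (L := L) (fundamentalRep (Fin N)) β
              (wordLoop (fundamentalRep (Fin N)) x w) / (N : ℝ) ^ 2)) +
      β / (2 * N) * ∑ ν ∈ Finset.univ.erase μ, ∑ ε : Bool,
        (wilsonExpectation (d := d) (L := L) (fundamentalRep (Fin N)) β
            (wordLoop (fundamentalRep (Fin N)) x (w ++ plaqWord μ ν ε)) -
          wilsonExpectation (d := d) (L := L) (fundamentalRep (Fin N)) β
            (wordLoop (fundamentalRep (Fin N)) x (w ++ (plaqWord μ ν ε).reverse)) -
          ((∫ U, (fundamentalRep (Fin N) (wordHolonomy U x w)).trace *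
                (fundamentalRep (Fin N) (wordHolonomy U x (plaqWord μ ν ε))).trace
              ∂(wilsonMeasure (d := d) (L := L) (fundamentalRep (Fin N)) β)).re / (N : ℝ) ^ 2 -
            (∫ U, (fundamentalRep (Fin N) (wordHolonomy U x w)).trace *
                (fundamentalRep (Fin N) (wordHolonomy U x (plaqWord μ ν ε).reverse)).trace
              ∂(wilsonMeasure (d := d) (L := L) (fundamentalRep (Fin N)) β)).re / (N : ℝ) ^ 2)) = 0 :=
  loopEquation_pairForm_specialUnitaryGroup N β x μ w hw (Word.small_of_dispBound hB hL)

/-- **`SU(3)`: the marked letter `d([], C) = w(C)` with the numeral `9`.** [folklore] -/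
theorem re_integral_trace_nil_mul_trace_su_three (β : ℝ) (x : Site d L) (v : Word d) :
    (∫ U, (fundamentalRep (Fin 3) (wordHolonomy U x ([] : Word d))).trace *
          (fundamentalRep (Fin 3) (wordHolonomy U x v)).trace
        ∂(wilsonMeasure (d := d) (L := L) (fundamentalRep (Fin 3)) β)).re / 9 =
      wilsonExpectation (d := d) (L := L) (fundamentalRep (Fin 3)) β (wordLoop (fundamentalRep (Fin 3)) x v) := by
  have h := re_integral_trace_nil_mul_trace_specialUnitaryGroup (L := L) 3 β x v
  simp only [show ((3 : ℕ) : ℝ) ^ 2 = 9 by norm_num] at h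
  exact h

/-- **Instance (`SU(3)`, `d = 3`): the PLAQUETTE row in real pair form**, on every torus `(ℤ/L)^3` with `L ≥ 3`:
for `P = +0 +1 −0 −1` at the link `(x, 0)` (forward occurrence set `{0}`, no backward occurrence, displacement bound
`1` — all by `decide` on `ℤ³`), `(8/9)·w(P) + (β/6)·Σ_{ν ≠ 0} Σ_ε (w(P·P̃) − w(P·P̃⁻¹) − (d(P, P̃) − d(P, P̃⁻¹))) = 0`
— the single-link Schwinger–Dyson row of the marked plaquette (the cell's rung-0 `SU(3)`, `D = 3` systems carry it
with every label canonicalised; that bookkeeping is the generators', not done here). [folklore] -/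
theorem loopEquation_pairForm_su_three_plaquette (β : ℝ) (x : Site 3 L) (hL : 3 ≤ L) :
    8 / 9 * wilsonExpectation (d := 3) (L := L) (fundamentalRep (Fin 3)) β
        (wordLoop (fundamentalRep (Fin 3)) x (Word.plaquette (0 : Fin 3) 1)) +
      β / 6 * ∑ ν ∈ Finset.univ.erase (0 : Fin 3), ∑ ε : Bool,
        (wilsonExpectation (d := 3) (L := L) (fundamentalRep (Fin 3)) β
            (wordLoop (fundamentalRep (Fin 3)) x (Word.plaquette (0 : Fin 3) 1 ++ plaqWord 0 ν ε)) -
          wilsonExpectation (d := 3) (L := L) (fundamentalRep (Fin 3)) β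
            (wordLoop (fundamentalRep (Fin 3)) x (Word.plaquette (0 : Fin 3) 1 ++ (plaqWord 0 ν ε).reverse)) -
          ((∫ U, (fundamentalRep (Fin 3) (wordHolonomy U x (Word.plaquette (0 : Fin 3) 1))).trace *
                (fundamentalRep (Fin 3) (wordHolonomy U x (plaqWord 0 ν ε))).trace
              ∂(wilsonMeasure (d := 3) (L := L) (fundamentalRep (Fin 3)) β)).re / 9 -
            (∫ U, (fundamentalRep (Fin 3) (wordHolonomy U x (Word.plaquette (0 : Fin 3) 1))).trace *
                (fundamentalRep (Fin 3) (wordHolonomy U x (plaqWord 0 ν ε).reverse)).trace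
              ∂(wilsonMeasure (d := 3) (L := L) (fundamentalRep (Fin 3)) β)).re / 9)) = 0 := by
  have hocc : ((Finset.range 4).filter ((Word.plaquette (0 : Fin 3) 1).fwdOccZ 0)) = {0} ∧
      ((Finset.range 4).filter ((Word.plaquette (0 : Fin 3) 1).bwdOccZ 0)) = ∅ ∧
      (Word.plaquette (0 : Fin 3) 1).DispBound 1 := by decide
  have h := loopEquation_pairForm_su_three (L := L) β x 0 (Word.plaquette (0 : Fin 3) 1) (endpoint_plaquette x 0 1)
    (Word.small_of_dispBound hocc.2.2 (by omega))
  rw [Word.length_plaquette, hocc.1, hocc.2.1] at h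
  simp only [Finset.sum_singleton, Finset.sum_empty, sub_zero, List.take_zero, List.drop_zero,
    re_integral_trace_nil_mul_trace_su_three] at h
  linear_combination h

end Concrete

end Summit.QuantumFields.GaugeBoot

end
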